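import Literature.NumberTheory.EllipticCurves.TunnellWeightTwoThetaProductsProofs
import Literature.NumberTheory.EllipticCurves.ModularCurveGenusTwoProofs
import HarnessLib

/-!
# The half-integral → integral-weight bridge: `M_{2k/2}(N, χ) ⊆ ModularForm (Γ₁(N)) k`, products,
# powers and change of level in `M_{k/2}(N, χ)`, and `θ(Q²z) ∈ M_{1/2}(4Q², 1)`

Width seat `bsd-line-cfram-p1-w8` g7 on crux stmt-BirchSwinnertonDyer-20372
`PrintCFram.BottomClassIndexLawFiveLe`, line `eisenstein-resource-bdp-line`, registry v23: typing sub-lane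
NF-B of the crux notes `Lines/eisenstein-resource-bdp-line-w8g6-notes.md` §3.2, done as KERNEL theorems in
the tree's own vocabulary of half-integral weight forms
(`Literature.NumberTheory.EllipticCurves.HalfIntegralWeightForms`: Shimura's `M_{k/2}(N, χ)` =
`halfIntModularForms k N χ`, the multiplied-out automorphy `IsThetaAutomorphic`, the cusp condition
`slashSq`). The registered stub `stub_cutForm` asks for a member `G·T` of a Katz family in weight
`k + (p+1)/2`, where `T` is the reduction of `θ₀(Q²z)^p` and `G` the reduction of the cut Cohen–Eisenstein
series; on the complex side this is the product `H_k(z) · θ(Q²z)^p` of a form of weight `k + 1/2` and the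
`p`-th power of the weight-`1/2` theta series `θ(Q²z)`, which must be shown to be a genuine
`ModularForm (Gamma1 (4Q²)) (k + (p+1)/2)` in Mathlib's sense (bounded at EVERY cusp, slash-invariant under
the image of `Γ₁(4Q²)` in `GL(2, ℝ)`). This file supplies, sorry-free:

* §1 `mul_mem_halfIntModularForms`, `pow_mem_halfIntModularForms`, `mem_halfIntModularForms_of_dvd` —
  `M_{k₁/2}(N,χ₁)·M_{k₂/2}(N,χ₂) ⊆ M_{(k₁+k₂)/2}(N,χ₁χ₂)`, powers, and `M_{k/2}(N,χ) ⊆ M_{k/2}(N',χ↑)` for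
  `N ∣ N'` (the tree had only the cusp × modular product, `Tunnell1983.mul_mem_halfIntCuspForms`).
* §2 `apply_smul_eq_of_mem_even`, `apply_smul_eq_of_mem_even_Gamma1`, `slash_eq_of_mem_even_Gamma1`,
  `isBoundedAtImInfty_slash_of_mem_even` — for EVEN index `2k` the theta-automorphy is genuine weight-`k`
  automorphy `F(γz) = χ(d) χ₋₄(d)^k (cz+d)^k F(z)` on `Γ₀(N)` (`j(γ,z)² = χ₋₄(d)(cz+d)`,
  `thetaFactor_sq`), hence `F ∣ₖ γ = F` on `Γ₁(N)` (`d ≡ 1 (mod N)`, `4 ∣ N`), and `F ∣ₖ g` is bounded at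
  `i∞` for every `g ∈ SL₂(ℤ)` (`|F ∣ₖ g|² = |slashSq (2k) F g|`).
* §3 **`exists_modularForm_of_mem_even`**: `4 ∣ N`, `F ∈ halfIntModularForms (2k) N χ` ⟹
  `∃ f : ModularForm (Gamma1 N) k, ⇑f = F` (Mathlib v4.32 `ModularForm (Γ : Subgroup (GL (Fin 2) ℝ))`,
  cusps via `Subgroup.IsArithmetic.isCusp_iff_isCusp_SL2Z` + `OnePoint.isBoundedAt_iff_forall_SL2Z`);
  `exists_cuspForm_of_mem_even` likewise. Generalises the tree's `Tunnell1983.cuspFormTwoOfMem`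
  (weight `4/2`, trivial character, `Γ₀`).
* §4 **`thetaMul_sq_mem_halfIntModularForms`**: `θ(Q²z) ∈ M_{1/2}(4Q², 1)` for every `Q ≥ 1`
  (`thetaMul_smul` with `(Q²/d) = 1`), its powers, and **NF-B**: `exists_modularForm_thetaMul_sq_pow` —
  `θ(Q²z)^{2j}` is (the function of) a `ModularForm (Gamma1 (4Q²)) j`.
* §5 THE NF-A SOCKET `exists_modularForm_mul_thetaMul_sq_pow`: for ANY `H ∈ M_{(2k+1)/2}(N, χ)` with
  `4Q² ∣ N` and `p` odd, `H · θ(Q²·)^p` is (the function of) a `ModularForm (Gamma1 N) (k + (p+1)/2)`; so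
  Cohen 1975 Thm 3.1 can be typed in ONE line of tree vocabulary (`H_k ∈ halfIntModularForms (2k+1) 4 1`)
  and the `G·T ∈ M (k + (p+1)/2)` slot of (CutForm⁶) is kernel glue from it, the periodic cut (NF-C) and
  the Katz facts (NF-D).

No new definitions, no named facts, no `sorry`. beyond-print theorem: NO (Shimura 1973 §1: "`M_{k/2}(N,χ)
· M_{l/2}(N,ψ) ⊆ M_{(k+l)/2}(N,χψ)`, `M_{2k/2}(N,χ) = M_k(Γ₀(N), χχ₋₄^k)`"; Tunnell 1983 p. 326: "`θ_t` is a
modular form of weight `1/2`, level `4t` and character `χ_t`"). BSD is not proved by any of this; no summit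
statement is proved by this seat; no registered stub is closed by this file.

## References

* G. Shimura, *On modular forms of half integral weight*, Ann. of Math. 97 (1973) 440–481, §1.
  [Shimura1973HalfIntegral]
* J. B. Tunnell, *A classical Diophantine problem and modular forms of weight 3/2*, Invent. Math. 72
  (1983) 323–334, p. 326. [Tunnell1983Congruent]
* H. Cohen, *Sums involving the values at negative integers of L-functions of quadratic characters*,
  Math. Ann. 217 (1975) 271–285, Thm. 3.1. [Cohen1975]
-/

set_option autoImplicit false
-- summit-side namespace (single-conjunct summit, D-0017 layout)
set_option linter.dupNamespace false

noncomputable section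

open scoped MatrixGroups NumberTheorySymbols ModularForm Manifold

open UpperHalfPlane hiding I
open Complex Filter Topology CongruenceSubgroup

namespace Summit.BirchSwinnertonDyer.BirchSwinnertonDyer.Theorems.PrintCFram.HalfIntegralBridge

open Literature.NumberTheory.EllipticCurves.ModularForms
open Literature.NumberTheory.EllipticCurves.Tunnell1983

variable {N : ℕ}

/-! ## §1 Products, powers and change of level in `M_{k/2}(N, χ)` -/

/-- **`M_{k₁/2}(N, χ₁) · M_{k₂/2}(N, χ₂) ⊆ M_{(k₁+k₂)/2}(N, χ₁χ₂)`** (Shimura 1973 §1): holomorphy,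
theta-automorphy (`IsThetaAutomorphic.mul`) and the cusp condition (`slashSq` is multiplicative) are all
closed under products. [cite: Shimura1973HalfIntegral, §1] -/
theorem mul_mem_halfIntModularForms {k₁ k₂ : ℕ} {χ₁ χ₂ : DirichletCharacter ℂ N} {f h : ℍ → ℂ}
    (hf : f ∈ halfIntModularForms k₁ N χ₁) (hh : h ∈ halfIntModularForms k₂ N χ₂) :
    f * h ∈ halfIntModularForms (k₁ + k₂) N (χ₁ * χ₂) := by
  refine ⟨hf.1.mul hh.1, IsThetaAutomorphic.mul hf.2.1 hh.2.1, fun g ↦ ?_⟩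
  rw [slashSq_mul]
  exact (hf.2.2 g).mul (hh.2.2 g)

/-- The constant function `1` lies in `M_{0/2}(N, 1)` (index `0`, trivial character): `d` is a unit
modulo `N` for `γ ∈ Γ₀(N)`, so `1(d) = 1`. [folklore] -/
theorem one_mem_halfIntModularForms_zero : (1 : ℍ → ℂ) ∈ halfIntModularForms 0 N 1 := by
  refine ⟨mdifferentiable_const, fun γ hγ z ↦ ?_, fun g ↦ ?_⟩
  · simp only [Pi.one_apply, pow_zero, mul_one, MulChar.one_apply (isUnit_d_of_mem_Gamma0 hγ)]
  · have : slashSq 0 (1 : ℍ → ℂ) g = Function.const ℍ (1 : ℂ) := by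
      funext z
      simp [slashSq]
    rw [this]
    exact Filter.const_boundedAtFilter _ _

/-- **Powers**: `f ∈ M_{k/2}(N, χ)` ⟹ `fⁿ ∈ M_{nk/2}(N, χⁿ)`. [cite: Shimura1973HalfIntegral, §1] -/
theorem pow_mem_halfIntModularForms {k : ℕ} {χ : DirichletCharacter ℂ N} {f : ℍ → ℂ}
    (hf : f ∈ halfIntModularForms k N χ) (n : ℕ) :
    f ^ n ∈ halfIntModularForms (n * k) N (χ ^ n) := by
  induction n with
  | zero => simpa using (one_mem_halfIntModularForms_zero (N := N))
  | succ n ih =>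
    rw [pow_succ, pow_succ, Nat.succ_mul]
    exact mul_mem_halfIntModularForms ih hf

/-- **Change of level in the automorphy**: theta-automorphy of level `N` and character `χ` implies
theta-automorphy of level `N'` and character `χ` regarded modulo `N'`, for `N ∣ N'`
(`Γ₀(N') ≤ Γ₀(N)`, the tree's `gamma0_le_gamma0_of_dvd`; `χ↑(d) = χ(d)` at the unit `d`). [folklore] -/
theorem isThetaAutomorphic_changeLevel {k N N' : ℕ} (h : N ∣ N') {χ : DirichletCharacter ℂ N}
    {f : ℍ → ℂ} (hf : IsThetaAutomorphic k N χ f) :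
    IsThetaAutomorphic k N' (DirichletCharacter.changeLevel h χ) f := by
  intro γ hγ z
  have hγN : γ ∈ Gamma0 N := gamma0_le_gamma0_of_dvd h hγ
  rw [hf γ hγN z]
  congr 2
  obtain ⟨u, hu⟩ := isUnit_d_of_mem_Gamma0 hγ
  rw [← hu, DirichletCharacter.changeLevel_eq_cast_of_dvd χ h u, hu, ZMod.cast_intCast h]

/-- **`M_{k/2}(N, χ) ⊆ M_{k/2}(N', χ↑)`** for `N ∣ N'` (the cusp condition does not see the level).
[cite: Shimura1973HalfIntegral, §1] -/
theorem mem_halfIntModularForms_of_dvd {k N N' : ℕ} (h : N ∣ N') {χ : DirichletCharacter ℂ N}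
    {f : ℍ → ℂ} (hf : f ∈ halfIntModularForms k N χ) :
    f ∈ halfIntModularForms k N' (DirichletCharacter.changeLevel h χ) :=
  ⟨hf.1, isThetaAutomorphic_changeLevel h hf.2.1, hf.2.2⟩

/-! ## §2 Even index `2k`: genuine weight-`k` automorphy and the weight-`k` cusp condition -/

/-- `j(γ, z)^{2k} = (χ₋₄(d) (cz + d))^k` (from `j(γ,z)² = χ₋₄(d)(cz + d)`, `thetaFactor_sq`). [folklore] -/
theorem thetaFactor_pow_two_mul {c d : ℤ} (h : Int.gcd c d = 1) (z : ℍ) (k : ℕ) :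
    thetaFactor c d z ^ (2 * k) = ((if d % 4 = 3 then -1 else 1) * ((c : ℂ) * z + d)) ^ k := by
  rw [pow_mul, thetaFactor_sq h z]

/-- **Weight-`k` automorphy from theta-automorphy of index `2k`** (Shimura 1973 §1:
`M_{2k/2}(N, χ) = M_k(Γ₀(N), χ χ₋₄^k)`): for `F ∈ M_{2k/2}(N, χ)`, `4 ∣ N`, `γ = (a b; c d) ∈ Γ₀(N)`,
`F(γz) = χ(d) · χ₋₄(d)^k · (cz + d)^k · F(z)`. [cite: Shimura1973HalfIntegral, §1] -/
theorem apply_smul_eq_of_mem_even (hN : 4 ∣ N) {k : ℕ} {χ : DirichletCharacter ℂ N} {F : ℍ → ℂ}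
    (hF : F ∈ halfIntModularForms (2 * k) N χ) {γ : SL(2, ℤ)} (hγ : γ ∈ Gamma0 N) (z : ℍ) :
    F (γ • z) = χ ((γ 1 1 : ℤ) : ZMod N) * (if (γ 1 1 : ℤ) % 4 = 3 then -1 else 1) ^ k *
      (((γ 1 0 : ℤ) : ℂ) * z + ((γ 1 1 : ℤ) : ℂ)) ^ k * F z := by
  rw [apply_smul_eq_of_mem hN hF hγ z, autFactor, thetaFactor_pow_two_mul (gcd_c_d_eq_one γ) z k,
    mul_pow]
  ring

/-- `d ≡ 1 (mod 4)` for `γ = (a b; c d) ∈ Γ₁(N)` when `4 ∣ N`. [folklore] -/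
theorem entry_mod_four_of_mem_Gamma1 (hN : 4 ∣ N) {γ : SL(2, ℤ)} (hγ : γ ∈ Gamma1 N) :
    (γ 1 1 : ℤ) % 4 = 1 := by
  have h1 := ((Gamma1_mem N γ).mp hγ).2.1
  have hdvd : (N : ℤ) ∣ (γ 1 1 : ℤ) - 1 := by
    rw [← ZMod.intCast_zmod_eq_zero_iff_dvd]
    push_cast
    rw [h1, sub_self]
  have h4 : ((4 : ℕ) : ℤ) ∣ (γ 1 1 : ℤ) - 1 := (Int.natCast_dvd_natCast.mpr hN).trans hdvd
  omega

/-- `χ(d) = 1` for `γ = (a b; c d) ∈ Γ₁(N)` (`d ≡ 1 (mod N)`). [folklore] -/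
theorem chi_apply_eq_one_of_mem_Gamma1 (χ : DirichletCharacter ℂ N) {γ : SL(2, ℤ)}
    (hγ : γ ∈ Gamma1 N) : χ ((γ 1 1 : ℤ) : ZMod N) = 1 := by
  rw [((Gamma1_mem N γ).mp hγ).2.1, map_one]

/-- **On `Γ₁(N)` the character and the sign disappear**: for `F ∈ M_{2k/2}(N, χ)`, `4 ∣ N`,
`γ = (a b; c d) ∈ Γ₁(N)`: `F(γz) = (cz + d)^k F(z)`. [cite: Shimura1973HalfIntegral, §1] -/
theorem apply_smul_eq_of_mem_even_Gamma1 (hN : 4 ∣ N) {k : ℕ} {χ : DirichletCharacter ℂ N}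
    {F : ℍ → ℂ} (hF : F ∈ halfIntModularForms (2 * k) N χ) {γ : SL(2, ℤ)} (hγ : γ ∈ Gamma1 N)
    (z : ℍ) : F (γ • z) = (((γ 1 0 : ℤ) : ℂ) * z + ((γ 1 1 : ℤ) : ℂ)) ^ k * F z := by
  rw [apply_smul_eq_of_mem_even hN hF (Gamma1_in_Gamma0 N hγ) z, chi_apply_eq_one_of_mem_Gamma1 χ hγ,
    entry_mod_four_of_mem_Gamma1 hN hγ]
  norm_num

/-- **Weight-`k` slash-invariance under `Γ₁(N)`** of members of `M_{2k/2}(N, χ)`, `4 ∣ N`.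
[cite: Shimura1973HalfIntegral, §1] -/
theorem slash_eq_of_mem_even_Gamma1 (hN : 4 ∣ N) {k : ℕ} {χ : DirichletCharacter ℂ N}
    {F : ℍ → ℂ} (hF : F ∈ halfIntModularForms (2 * k) N χ) {γ : SL(2, ℤ)} (hγ : γ ∈ Gamma1 N) :
    F ∣[(k : ℤ)] (γ : GL (Fin 2) ℝ) = F := by
  rw [← ModularForm.SL_slash]
  funext z
  rw [ModularForm.slash_action_eq'_iff, apply_smul_eq_of_mem_even_Gamma1 hN hF hγ z, zpow_natCast]

/-- `|(F |ₖ g)(z)|² = |slashSq (2k) F g (z)|` for `g ∈ SL₂(ℤ)`. [folklore] -/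
theorem norm_slash_sq_eq (k : ℕ) (F : ℍ → ℂ) (g : SL(2, ℤ)) (z : ℍ) :
    ‖(F ∣[(k : ℤ)] (g : GL (Fin 2) ℝ)) z‖ ^ 2 = ‖slashSq (2 * k) F g z‖ := by
  rw [← ModularForm.SL_slash, ModularForm.SL_slash_apply, slashSq, norm_mul, norm_div, norm_pow,
    norm_pow, norm_zpow, mul_pow, zpow_neg, zpow_natCast, inv_pow, ← pow_mul, mul_comm k 2,
    div_eq_mul_inv]

/-- **The weight-`k` cusp condition** for members of `M_{2k/2}(N, χ)`: `F |ₖ g` is bounded at `i∞` for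
every `g ∈ SL₂(ℤ)` (square root of the bound for `slashSq (2k) F g`). [cite: Shimura1973HalfIntegral, §1] -/
theorem isBoundedAtImInfty_slash_of_mem_even {k : ℕ} {χ : DirichletCharacter ℂ N} {F : ℍ → ℂ}
    (hF : F ∈ halfIntModularForms (2 * k) N χ) (g : SL(2, ℤ)) :
    IsBoundedAtImInfty (F ∣[(k : ℤ)] (g : GL (Fin 2) ℝ)) := by
  have h := hF.2.2 g
  rw [isBoundedAtImInfty_iff] at h ⊢
  obtain ⟨M, A, hM⟩ := h
  refine ⟨Real.sqrt M, A, fun z hz ↦ ?_⟩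
  have h2 : ‖(F ∣[(k : ℤ)] (g : GL (Fin 2) ℝ)) z‖ ^ 2 ≤ M := by
    rw [norm_slash_sq_eq]; exact hM z hz
  calc ‖(F ∣[(k : ℤ)] (g : GL (Fin 2) ℝ)) z‖
      = Real.sqrt (‖(F ∣[(k : ℤ)] (g : GL (Fin 2) ℝ)) z‖ ^ 2) := (Real.sqrt_sq (norm_nonneg _)).symm
    _ ≤ Real.sqrt M := Real.sqrt_le_sqrt h2

/-- **The weight-`k` cusp-form condition** for members of `S_{2k/2}(N, χ)`: `F |ₖ g → 0` at `i∞` for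
every `g ∈ SL₂(ℤ)`. [cite: Shimura1973HalfIntegral, §1] -/
theorem isZeroAtImInfty_slash_of_mem_even_cusp {k : ℕ} {χ : DirichletCharacter ℂ N} {F : ℍ → ℂ}
    (hF : F ∈ halfIntCuspForms (2 * k) N χ) (g : SL(2, ℤ)) :
    IsZeroAtImInfty (F ∣[(k : ℤ)] (g : GL (Fin 2) ℝ)) := by
  have h := hF.2.2 g
  rw [isZeroAtImInfty_iff] at h ⊢
  intro ε hε
  obtain ⟨A, hA⟩ := h (ε ^ 2) (by positivity)
  refine ⟨A, fun z hz ↦ ?_⟩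
  have h2 : ‖(F ∣[(k : ℤ)] (g : GL (Fin 2) ℝ)) z‖ ^ 2 ≤ ε ^ 2 := by
    rw [norm_slash_sq_eq]; exact hA z hz
  calc ‖(F ∣[(k : ℤ)] (g : GL (Fin 2) ℝ)) z‖
      = Real.sqrt (‖(F ∣[(k : ℤ)] (g : GL (Fin 2) ℝ)) z‖ ^ 2) := (Real.sqrt_sq (norm_nonneg _)).symm
    _ ≤ Real.sqrt (ε ^ 2) := Real.sqrt_le_sqrt h2
    _ = ε := Real.sqrt_sq hε.le

/-! ## §3 The bridge: `M_{2k/2}(N, χ) ⊆ ModularForm (Γ₁(N)) k` -/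

/-- **THE BRIDGE `M_{2k/2}(N, χ) → ModularForm (Γ₁(N)) k`** (`4 ∣ N`): a holomorphic function on `ℍ`
that is theta-automorphic of EVEN index `2k` for `Γ₀(N)` with character `χ` and satisfies Shimura's cusp
condition at every cusp is (the underlying function of) a Mathlib modular form of weight `k` for the
image of `Γ₁(N)` in `GL(2, ℝ)`: slash-invariance by `slash_eq_of_mem_even_Gamma1`, holomorphy, and
boundedness at every cusp `c` of the arithmetic group `Γ₁(N)` (the cusps are `SL₂(ℤ) · ∞`, and at
`g · ∞` boundedness of `F |ₖ g` suffices, `OnePoint.isBoundedAt_iff_forall_SL2Z`).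
[cite: Shimura1973HalfIntegral, §1] -/
theorem exists_modularForm_of_mem_even [NeZero N] (hN : 4 ∣ N) {k : ℕ}
    {χ : DirichletCharacter ℂ N} {F : ℍ → ℂ} (hF : F ∈ halfIntModularForms (2 * k) N χ) :
    ∃ f : ModularForm (Gamma1 N) (k : ℤ), ⇑f = F :=
  ⟨{ toFun := F
     slash_action_eq' := fun γ hγ ↦ by
       obtain ⟨γ₀, hγ₀, rfl⟩ := hγ
       exact slash_eq_of_mem_even_Gamma1 hN hF hγ₀
     holo' := hF.1
     bdd_at_cusps' := fun {c} hc ↦ by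
       rw [Subgroup.IsArithmetic.isCusp_iff_isCusp_SL2Z] at hc
       rw [OnePoint.isBoundedAt_iff_forall_SL2Z hc]
       intro γ _
       exact isBoundedAtImInfty_slash_of_mem_even hF γ }, rfl⟩

/-- **The cuspidal bridge `S_{2k/2}(N, χ) → CuspForm (Γ₁(N)) k`** (`4 ∣ N`).
[cite: Shimura1973HalfIntegral, §1] -/
theorem exists_cuspForm_of_mem_even [NeZero N] (hN : 4 ∣ N) {k : ℕ}
    {χ : DirichletCharacter ℂ N} {F : ℍ → ℂ} (hF : F ∈ halfIntCuspForms (2 * k) N χ) :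
    ∃ f : CuspForm (Gamma1 N) (k : ℤ), ⇑f = F :=
  ⟨{ toFun := F
     slash_action_eq' := fun γ hγ ↦ by
       obtain ⟨γ₀, hγ₀, rfl⟩ := hγ
       exact slash_eq_of_mem_even_Gamma1 hN (halfIntCuspForms_le_halfIntModularForms _ N χ hF) hγ₀
     holo' := hF.1
     zero_at_cusps' := fun {c} hc ↦ by
       rw [Subgroup.IsArithmetic.isCusp_iff_isCusp_SL2Z] at hc
       rw [OnePoint.isZeroAt_iff_forall_SL2Z hc]
       intro γ _
       exact isZeroAtImInfty_slash_of_mem_even_cusp hF γ }, rfl⟩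

/-! ## §4 `θ(Q²z) ∈ M_{1/2}(4Q², 1)` and NF-B: `θ(Q²z)^{2j} ∈ ModularForm (Γ₁(4Q²)) j` -/

/-- `(Q²/|d|) = 1` for the bottom row `(c, d)` of any `γ ∈ SL₂(ℤ)` with `Q ∣ c` (`(Q/|d|)² = 1` as
`gcd(Q, d) = 1`). [folklore] -/
theorem jacobiSym_sq_entry_eq_one {Q : ℕ} {γ : SL(2, ℤ)} (h : (Q : ℤ) ∣ γ 1 0) :
    J(((Q ^ 2 : ℕ) : ℤ) | (γ 1 1 : ℤ).natAbs) = 1 := by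
  rw [Nat.cast_pow, jacobiSym.pow_left]
  exact jacobiSym_sq_eq_one_of_dvd h (gcd_c_d_eq_one γ)

/-- **Theta-automorphy of `θ(Q²z)` of weight `1/2`, level `4Q²`, TRIVIAL character**:
`θ_{Q²}(γz) θ(z) = θ(γz) θ_{Q²}(z)` on `Γ₀(4Q²)` (`θ_{Q²}(γz) = (Q²/|d|) j(γ,z) θ_{Q²}(z)` by the tree's
`thetaMul_smul`, with `(Q²/|d|) = 1`; `θ(γz) = j(γ,z) θ(z)`). [cite: Tunnell1983Congruent, p. 326] -/
theorem isThetaAutomorphic_thetaMul_sq {Q : ℕ} (hQ : 0 < Q) :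
    IsThetaAutomorphic 1 (4 * Q ^ 2) 1 (thetaMul (Q ^ 2)) := by
  intro γ hγ z
  have hc : ((4 * Q ^ 2 : ℕ) : ℤ) ∣ γ 1 0 := dvd_entry_of_mem_Gamma0 (4 * Q ^ 2) hγ
  have h4s : (4 * (Q ^ 2 : ℕ) : ℤ) ∣ γ 1 0 := by exact_mod_cast hc
  have hQc : (Q : ℤ) ∣ γ 1 0 := by
    refine dvd_trans ?_ hc
    exact ⟨4 * Q, by push_cast; ring⟩
  rw [thetaMul_smul (pow_pos hQ 2) h4s z,
    shimuraTheta_smul_eq_thetaFactor (dvd_mul_right 4 (Q ^ 2)) hγ z,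
    MulChar.one_apply (isUnit_d_of_mem_Gamma0 hγ), jacobiSym_sq_entry_eq_one hQc]
  push_cast
  ring

/-- **`θ(Q²z) ∈ M_{1/2}(4Q², 1)`** for every `Q ≥ 1` ("`θ_t` is a modular form of weight `1/2`, level
`4t` and character `χ_t`", Tunnell p. 326, `χ_t` trivial for square `t`; holomorphy and the cusp
condition `isBoundedAtImInfty_slashSq_thetaMul` are the tree's). [cite: Tunnell1983Congruent, p. 326] -/
theorem thetaMul_sq_mem_halfIntModularForms {Q : ℕ} (hQ : 0 < Q) :
    thetaMul (Q ^ 2) ∈ halfIntModularForms 1 (4 * Q ^ 2) 1 :=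
  ⟨mdifferentiable_thetaMul (pow_pos hQ 2), isThetaAutomorphic_thetaMul_sq hQ,
    isBoundedAtImInfty_slashSq_thetaMul (pow_pos hQ 2)⟩

/-- **`θ(Q²z)ⁿ ∈ M_{n/2}(4Q², 1)`**. [cite: Tunnell1983Congruent, p. 326] -/
theorem thetaMul_sq_pow_mem_halfIntModularForms {Q : ℕ} (hQ : 0 < Q) (n : ℕ) :
    thetaMul (Q ^ 2) ^ n ∈ halfIntModularForms n (4 * Q ^ 2) 1 := by
  simpa using pow_mem_halfIntModularForms (thetaMul_sq_mem_halfIntModularForms hQ) n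

/-- **NF-B (crux notes w8g6 §3.2) IN THE KERNEL: `θ(Q²z)^{2j}` is a modular form of weight `j` on
`Γ₁(4Q²)`** in Mathlib's sense — in particular `θ(Q²z)² ∈ ModularForm (Gamma1 (4Q²)) 1`, whose
`q`-expansion is `Σ_{(b,b') ∈ ℤ²} q^{Q²(b²+b'²)}`. [cite: Tunnell1983Congruent, p. 326]
[cite: Shimura1973HalfIntegral, §1] -/
theorem exists_modularForm_thetaMul_sq_pow {Q : ℕ} (hQ : 0 < Q) (j : ℕ) :
    ∃ f : ModularForm (Gamma1 (4 * Q ^ 2)) (j : ℤ), ⇑f = thetaMul (Q ^ 2) ^ (2 * j) := by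
  haveI : NeZero (4 * Q ^ 2) := ⟨by positivity⟩
  have hmem := thetaMul_sq_pow_mem_halfIntModularForms hQ (2 * j)
  exact exists_modularForm_of_mem_even (dvd_mul_right 4 (Q ^ 2)) hmem

/-! ## §5 The NF-A socket: `H · θ(Q²·)^p ∈ ModularForm (Γ₁(N)) (k + (p+1)/2)` for `H ∈ M_{(2k+1)/2}(N, χ)` -/

/-- **THE NF-A SOCKET** (crux notes w8g6 §3.2): for `4Q² ∣ N`, ANY `H ∈ M_{(2k+1)/2}(N, χ)` and `p` odd,
the product `H · θ(Q²·)^p` is (the function of) a `ModularForm (Gamma1 N) (k + (p+1)/2)`: `θ(Q²·)^p ∈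
M_{p/2}(4Q², 1) ⊆ M_{p/2}(N, 1↑)`, the product lies in `M_{(2k+1+p)/2}(N, χ·1↑)` with `2k+1+p =
2(k + (p+1)/2)`, and the bridge applies. With `H = H_k` Cohen's form of weight `k + 1/2` on `Γ₀(4)`
(Cohen 1975 Thm 3.1, to be typed as `H_k ∈ halfIntModularForms (2k+1) 4 1`) this is the complex form
whose cut reduces to `G·T` in (CutForm⁶). [cite: Shimura1973HalfIntegral, §1] [cite: Cohen1975, Thm. 3.1] -/
theorem exists_modularForm_mul_thetaMul_sq_pow [NeZero N] {Q : ℕ} (hQ : 0 < Q) (hN : 4 * Q ^ 2 ∣ N)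
    {k p : ℕ} (hp : Odd p) {χ : DirichletCharacter ℂ N} {H : ℍ → ℂ}
    (hH : H ∈ halfIntModularForms (2 * k + 1) N χ) :
    ∃ f : ModularForm (Gamma1 N) ((k + (p + 1) / 2 : ℕ) : ℤ), ⇑f = H * thetaMul (Q ^ 2) ^ p := by
  have h4 : 4 ∣ N := (dvd_mul_right 4 (Q ^ 2)).trans hN
  have hT := mem_halfIntModularForms_of_dvd hN (thetaMul_sq_pow_mem_halfIntModularForms hQ p)
  have hprod := mul_mem_halfIntModularForms hH hT
  obtain ⟨r, rfl⟩ := hp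
  have he : 2 * k + 1 + (2 * r + 1) = 2 * (k + (2 * r + 1 + 1) / 2) := by omega
  rw [he] at hprod
  exact exists_modularForm_of_mem_even h4 hprod

/-- The level-`4` case packaged at the output level `4Q²`: `H ∈ M_{(2k+1)/2}(4, χ)` (the level of Cohen's
`H_k`), `p` odd ⟹ `H · θ(Q²·)^p ∈ ModularForm (Gamma1 (4Q²)) (k + (p+1)/2)`.
[cite: Shimura1973HalfIntegral, §1] [cite: Cohen1975, Thm. 3.1] -/
theorem exists_modularForm_mul_thetaMul_sq_pow_of_level_four {Q : ℕ} (hQ : 0 < Q) {k p : ℕ}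
    (hp : Odd p) {χ : DirichletCharacter ℂ 4} {H : ℍ → ℂ}
    (hH : H ∈ halfIntModularForms (2 * k + 1) 4 χ) :
    ∃ f : ModularForm (Gamma1 (4 * Q ^ 2)) ((k + (p + 1) / 2 : ℕ) : ℤ),
      ⇑f = H * thetaMul (Q ^ 2) ^ p := by
  haveI : NeZero (4 * Q ^ 2) := ⟨by positivity⟩
  exact exists_modularForm_mul_thetaMul_sq_pow hQ (dvd_refl _) hp
    (mem_halfIntModularForms_of_dvd (dvd_mul_right 4 (Q ^ 2)) hH)

end Summit.BirchSwinnertonDyer.BirchSwinnertonDyer.Theorems.PrintCFram.HalfIntegralBridge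

end
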